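import Summits.ABC.IUTFork.Cor312LicenceShallowRealTame
import Summits.ABC.IUTFork.Cor312NotLicencePrVolSharpRealises
import Summits.ABC.IUTFork.Conditional.AbcOfSHvolSplitHeight
import HarnessLib

/-!
# [IUTchIII] Cor. 3.12 — the (xi-f) licence / branch C's hull-level antecedent at the sharp real settings for
# REALISING pilot ideles: INHABITED whenever every bad place is TAME with `1 ≤ P_q(v)` and `(l⋇)²·P_q(v) < e_v + 1`

PROOF-ONLY record file (D-0012; 0 definitions, 0 `Prop` facts) of the abc-iut cell (WAVE-5 prover seat abc-iut-w5-d236,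
gen 8; row «LICENCE-SHALLOW-RAMIFIED-KERNEL» part (C)). TAKES NO SIDE on [IUTchIII] Cor. 3.12 or on any author.
The companions prove the licence from one-factor movers (`Cor312LicenceShallowReal`) and supply the movers in the tame
shallow NORM window (`Cor312LicenceShallowRealTame`). This file reads that window in PILOT-DEGREE terms for ideles
REALISING the pilot divisors in Dupuy–Hilado's normalisation (3.4) (abc-iut-c312-7's `ht`/`htq`, the hypotheses branch
C's certificates carry): `log ‖t_{q,v}‖ = −P_q(v)·ln|κ(v)|/n_v`, `log ‖t_{Θ,i,v}‖ = −P_{Θ,i}(v)·ln|κ(v)|/n_v`,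
`P_{Θ,i} = (i+1)²·P_q`, `P_q(v) = ord_v(q_v)/(2l)` (`PilotData.qPilot_apply_of_mem`).

* §1 `norm_qIdele_eq_rpow_of_realises` / `norm_thetaIdele_eq_rpow_of_realises` — in the rescaled completion
  (`‖·‖ = |·|_v^{1/n_v}`): **`‖t_{q,v}‖ = p^{−P_q(v)/e_v}`**, **`‖t_{Θ,i,v}‖ = p^{−(i+1)²·P_q(v)/e_v}`** (`ln|κ(v)|/n_v = ln p/e_v`,
  `Summit.ABC.IUTFork.logNorm_div_localDegree_eq_log_div_ramIdx`);
* §2 **`licence_settingPrVolSharp_of_realises_shallow`** / `…settingDHVolSharp…` and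
  **`exists_qPinned_and_hull_settingPrVolSharp_of_realises_shallow`** — for realising ideles (non-zero; q-ideles units off
  `S`), IF every `v ∈ S` is TAME (`p_v > 2`, `e_v ≤ p_v − 2`) with **`1 ≤ P_q(v)` and `(l⋇)²·P_q(v) < e_v + 1`** — in print's
  quantities `ord_v(q_v) ≥ 2l` and `(l⋇)²·ord_v(q_v) < 2l·(e_v + 1)` — THEN the (xi-f) licence holds at abc-iut-c312-7's /
  c312-3's sharp settings and branch C's «∃ ρ qK, QPinned ∧ PilotKummerCompatHull» is inhabited there (any columns): the
  norm window `‖p‖·‖ϖ_v‖ < ‖t_{Θ,i,v}‖ ≤ ‖ϖ_v‖ ⊇ ‖t_{q,v}‖` of the companion is `1 ≤ (i+1)²·P_q(v) < e_v + 1` (`‖ϖ_v‖ = p^{−1/e_v}`).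

So, in OUR typed objects and for realising ideles, the hull-level licence at data all of whose bad places are tame is
INHABITED on the degree locus above (shallow `q`, heavy ramification: `e_v ≥ (l⋇)²·P_q(v) > (l⋇)² − 1`) and REFUTED at deep
data (abc-iut-w4-d026 `not_exists_qPinned_hull_settingPrVolSharp_of_realising_deep`); the strip in between is the lattice-
content regime (abc-iut-w5-d180 «LICENCE-MULTISLOT-LOWER» / abc-iut-w4-d026 «EXPLICIT-DEPTH-SHARP-TAME»). Whether GENUINE
initial Θ-data (K-level provenance, abc-iut-C-cert-3 v5K) meet the locus is NOT claimed here. HONEST SCOPE as in the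
companions: OUR sharp containers (Θ-regions constant in `m`), Dupuy–Hilado's typed (Ind2); the licence is a STRONGER-THAN-
PRINT form; nothing about the printed GLOBAL inequality; nothing asserts or refutes [IUTchIII] Cor. 3.12.
[cite: DupuyHilado2025, §3.3, §3.4, §3.9, §4.9] [cite: NeukirchANT1999, Ch. I §8 Prop. (8.2), Ch. II Prop. (5.5)]
[claim: Mochizuki2012, status: disputed] for every IUT sentence quoted. typed ≠ proved; instantiated ≠ endorsed.
-/

noncomputable section

open Set Metric Function NumberField IsDedekindDomain
open scoped Pointwise

namespace Summit.ABC.IUTFork.Thm311.Real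

open Cor312 Cor312.Setting Cor312Vol Literature.IUT.LogThetaLattice Literature.IUT.LogVolume
open Literature.NumberTheory.NumberFields Literature.NumberTheory.GaloisRepresentations.Ultrametric

variable {F : Type} [Field F] [NumberField F] (X : PilotData F) {logv : PadicLogs F} (hlog : LogvAnalytic logv)
  (M : Type) [Field M] [NumberField M]
  (archPk : ∀ (j : (thetaIndex X).Label) (vQ : (thetaIndex X).VQ), Set ((logShellsDH X logv).Packet j vQ))
  (archSub : ∀ (j : (thetaIndex X).Label) (v : (thetaIndex X).V),
    Set ((logShellsDH X logv).Packet j ((thetaIndex X).over v)))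
  (Ψ : ℤ → ∀ v : (thetaIndex X).V, v ∈ (thetaIndex X).Vbad → Set ((logShellsDH X logv).StarPacket v))
  (act : ℤ → ∀ v : (thetaIndex X).V, v ∈ (thetaIndex X).Vbad →
    (logShellsDH X logv).StarPacket v → Module.End ℚ ((logShellsDH X logv).StarPacket v))
  (Mmod : ℤ → ∀ j : (thetaIndex X).LabelStar, Set ((logShellsDH X logv).GlobalPacket j.1))
  (region : ℤ → ∀ j : (thetaIndex X).LabelStar, FinDivisor M → ∀ vQ : (thetaIndex X).VQ,
    Set ((logShellsDH X logv).Packet j.1 vQ))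
  (n : ℤ) {HT : Type} {LogLink : HT → HT → Type} {IsFull : ∀ {s t : HT}, LogLink s t → Prop}
  (lat : LGPGaussianLogThetaLattice LogLink IsFull)
  {Frd : Type} {IsoF : Frd → Frd → Type} {Ob : Frd → Type} {realify : Frd → Frd} {Strip : Type}
  {IsoS : Strip → Strip → Type} {Mv : ∀ v : (thetaIndex X).V, v ∈ (thetaIndex X).Vbad → Type}
  [∀ v h, Monoid (Mv v h)]
  (sig : GlobalLGPFrobenioidSignature (thetaIndex X).lstar (thetaIndex X).V (· ∈ (thetaIndex X).Vbad)
    Frd IsoF Ob realify Strip IsoS Mv)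
  (split : SplittingMonoids Mv) {ObΔ : Type} {N : ∀ v : (thetaIndex X).V, v ∈ (thetaIndex X).Vbad → Type}
  [∀ v h, Monoid (N v h)] (qData : QPilotData ObΔ N)
  (tq : ∀ (pp : Nat.Primes) (x : (thetaIndex X).Fibre (.inr pp)), haveI : Fact (pp : ℕ).Prime := ⟨pp.2⟩; kOf X pp.1 x)
  (t : ∀ (pp : Nat.Primes) (_ : Fin X.lstar) (x : (thetaIndex X).Fibre (.inr pp)),
    haveI : Fact (pp : ℕ).Prime := ⟨pp.2⟩; kOf X pp.1 x)
  (htq0 : ∀ pp x, tq pp x ≠ 0)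
  (htq1 : ∀ (pp : Nat.Primes) (x : (thetaIndex X).Fibre (.inr pp)),
    haveI : Fact (pp : ℕ).Prime := ⟨pp.2⟩; placeOf X pp.1 x ∉ X.S → ‖tq pp x‖ = 1)
  (col : ℤ → Column (logShellsDH X logv))
  (ht0 : ∀ pp i x, t pp i x ≠ 0)
  (ht : ∀ (pp : Nat.Primes) (i : Fin X.lstar) (x : (thetaIndex X).Fibre (.inr pp)),
    haveI : Fact (pp : ℕ).Prime := ⟨pp.2⟩
    Real.log ‖t pp i x‖ = -(X.thetaPilot i (placeOf X pp.1 x)) * logNorm F (placeOf X pp.1 x) /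
      localDegree F (placeOf X pp.1 x))
  (htq : ∀ (pp : Nat.Primes) (x : (thetaIndex X).Fibre (.inr pp)),
    haveI : Fact (pp : ℕ).Prime := ⟨pp.2⟩
    Real.log ‖tq pp x‖ = -(X.qPilot (placeOf X pp.1 x)) * logNorm F (placeOf X pp.1 x) /
      localDegree F (placeOf X pp.1 x))

/-! ## 1. Norms of realising ideles in the rescaled completion: `‖t_q‖ = p^{−P_q/e}`, `‖t_Θ,i‖ = p^{−(i+1)²P_q/e}` -/

include htq0 htq in
/-- **`‖t_{q,v}‖ = p^{−P_q(v)/e_v}`** for a q-idele realising `P_q` (Dupuy–Hilado (3.4); rescaled norm `|·|_v^{1/n_v}`,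
`ln|κ(v)|/n_v = ln p/e_v`). [cite: DupuyHilado2025, §3.4] [cite: NeukirchANT1999, Ch. I §8 Prop. (8.2)] -/
theorem norm_qIdele_eq_rpow_of_realises (pp : Nat.Primes) (x : (thetaIndex X).Fibre (.inr pp)) :
    haveI : Fact (pp : ℕ).Prime := ⟨pp.2⟩
    ‖tq pp x‖ = ((pp : ℕ) : ℝ) ^ (-(X.qPilot (placeOf X pp.1 x)) / (ramIdx F (placeOf X pp.1 x) : ℝ)) := by
  haveI : Fact (pp : ℕ).Prime := ⟨pp.2⟩
  have hq0 : 0 < ‖tq pp x‖ := norm_pos_iff.mpr (htq0 pp x)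
  have hp0 : (0 : ℝ) < ((pp : ℕ) : ℝ) := by exact_mod_cast pp.2.pos
  have hres : residueChar F (placeOf X pp.1 x) = (pp : ℕ) :=
    residueChar_eq_of_natCast_mem (pp : ℕ) (natCast_mem_placeOf X pp.1 x)
  have h := htq pp x
  rw [mul_div_assoc, logNorm_div_localDegree_eq_log_div_ramIdx, hres] at h
  rw [← Real.exp_log hq0, h, Real.rpow_def_of_pos hp0]
  congr 1
  ring

include ht0 ht htq0 htq in
/-- **`‖t_{Θ,i,v}‖ = p^{−(i+1)²·P_q(v)/e_v}`** for Θ-ideles realising `P_Θ = (i+1)²·P_q`. [cite: DupuyHilado2025, §3.3, §3.4] -/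
theorem norm_thetaIdele_eq_rpow_of_realises (pp : Nat.Primes) (i : Fin X.lstar) (x : (thetaIndex X).Fibre (.inr pp)) :
    haveI : Fact (pp : ℕ).Prime := ⟨pp.2⟩
    ‖t pp i x‖ = ((pp : ℕ) : ℝ) ^ (-((((i : ℕ) + 1 : ℕ) : ℝ) ^ 2 * X.qPilot (placeOf X pp.1 x)) /
      (ramIdx F (placeOf X pp.1 x) : ℝ)) := by
  haveI : Fact (pp : ℕ).Prime := ⟨pp.2⟩
  have hp0 : (0 : ℝ) ≤ ((pp : ℕ) : ℝ) := by positivity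
  rw [norm_thetaIdele_eq_pow_of_realises X t ht0 ht tq htq0 htq pp i x,
    norm_qIdele_eq_rpow_of_realises X tq htq0 htq pp x, ← Real.rpow_mul_natCast hp0]
  congr 1
  push_cast
  ring

/-! ## 2. The norm window of the companion from the degree locus -/

include htq0 ht0 ht htq in
/-- **The tame shallow NORM window from the DEGREE locus**: for realising ideles, at a bad place `v ∈ S` over `p` that is tame with
`1 ≤ P_q(v)` and `(l⋇)²·P_q(v) < e_v + 1`, every label `i` has `‖p‖·‖ϖ_v‖ < ‖t_{Θ,i,v}‖ ≤ ‖ϖ_v‖` and `‖t_{q,v}‖ ≤ ‖ϖ_v‖` for a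
uniformizer `ϖ_v` (`‖ϖ_v‖ = p^{−1/e_v}`; the window is `1 ≤ (i+1)²·P_q(v) < e_v + 1`). [cite: DupuyHilado2025, §3.4]
[cite: NeukirchANT1999, Ch. II Prop. (5.5)] -/
theorem window_of_realises_shallow
    (htame : ∀ v ∈ X.S, 2 < residueChar F v ∧ ramIdx F v ≤ residueChar F v - 2)
    (hdeg : ∀ v ∈ X.S, 1 ≤ X.qPilot v ∧ ((X.lstar : ℕ) : ℝ) ^ 2 * X.qPilot v < (ramIdx F v : ℝ) + 1)
    (pp : Nat.Primes) (i : Fin (thetaIndex X).lstar) (x : (thetaIndex X).Fibre (.inr pp))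
    (hx : haveI : Fact (pp : ℕ).Prime := ⟨pp.2⟩; placeOf X pp.1 x ∈ X.S) :
    haveI : Fact (pp : ℕ).Prime := ⟨pp.2⟩
    2 < (pp : ℕ) ∧ (placeOf X pp.1 x).asIdeal.ramificationIdx ℤ ≤ (pp : ℕ) - 2 ∧
      ∃ ϖ : (kOf X pp.1 x)ˣ, IsUniformizer ϖ ∧
        ‖(pp : ℚ_[pp])‖ * ‖(ϖ : kOf X pp.1 x)‖ < ‖t pp i x‖ ∧ ‖t pp i x‖ ≤ ‖(ϖ : kOf X pp.1 x)‖ ∧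
        ‖tq pp x‖ ≤ ‖(ϖ : kOf X pp.1 x)‖ := by
  haveI : Fact (pp : ℕ).Prime := ⟨pp.2⟩
  set v := placeOf X pp.1 x with hv
  have hpv : ((pp : ℕ) : 𝓞 F) ∈ v.asIdeal := natCast_mem_placeOf X pp.1 x
  have hres : residueChar F v = (pp : ℕ) := residueChar_eq_of_natCast_mem (pp : ℕ) hpv
  have he : ramIdx F v = v.asIdeal.ramificationIdx ℤ := ramIdx_eq F v
  obtain ⟨hp2, hev⟩ := htame v hx
  rw [hres] at hp2 hev
  obtain ⟨hP1, hPe⟩ := hdeg v hx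
  -- a uniformizer of norm `p^{−1/e_v}`
  obtain ⟨ϖ, hϖ, hϖn⟩ := exists_isUniformizer_rescaledCompletion F pp.1 v hpv
  rw [← he] at hϖn
  have hp1 : (1 : ℝ) < ((pp : ℕ) : ℝ) := by exact_mod_cast pp.2.one_lt
  have hp0 : (0 : ℝ) < ((pp : ℕ) : ℝ) := by positivity
  have he0 : (0 : ℝ) < (ramIdx F v : ℝ) := by exact_mod_cast Nat.pos_of_ne_zero (ramIdx_ne_zero F v)
  -- the label coefficient `c = (i+1)²`, `1 ≤ c ≤ (l⋇)²`
  set c : ℝ := (((i : ℕ) + 1 : ℕ) : ℝ) ^ 2 with hc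
  have hc1 : 1 ≤ c := by
    have : (1 : ℝ) ≤ (((i : ℕ) + 1 : ℕ) : ℝ) := by exact_mod_cast Nat.succ_le_succ (Nat.zero_le _)
    nlinarith
  have hcl : c ≤ ((X.lstar : ℕ) : ℝ) ^ 2 := by
    have : (((i : ℕ) + 1 : ℕ) : ℝ) ≤ ((X.lstar : ℕ) : ℝ) := by exact_mod_cast i.2
    have h0 : (0 : ℝ) ≤ (((i : ℕ) + 1 : ℕ) : ℝ) := by positivity
    nlinarith
  have hP0 : 0 ≤ X.qPilot v := le_trans zero_le_one hP1
  have hcP : c * X.qPilot v < (ramIdx F v : ℝ) + 1 :=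
    lt_of_le_of_lt (mul_le_mul_of_nonneg_right hcl hP0) hPe
  -- the three norms as powers of `p`
  have hnq : ‖tq pp x‖ = ((pp : ℕ) : ℝ) ^ (-(X.qPilot v) / (ramIdx F v : ℝ)) :=
    norm_qIdele_eq_rpow_of_realises X tq htq0 htq pp x
  have hnt : ‖t pp i x‖ = ((pp : ℕ) : ℝ) ^ (-(c * X.qPilot v) / (ramIdx F v : ℝ)) :=
    norm_thetaIdele_eq_rpow_of_realises X tq t htq0 ht0 ht htq pp i x
  have hnp : ‖((pp : ℕ) : ℚ_[pp])‖ = ((pp : ℕ) : ℝ) ^ (-(1 : ℝ)) := by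
    rw [Padic.norm_p, Real.rpow_neg_one]
  refine ⟨hp2, by rw [← he]; exact hev, ϖ, hϖ, ?_, ?_, ?_⟩
  · -- `‖p‖·‖ϖ‖ < ‖t_Θ‖`: `−1 − 1/e < −c·P_q/e`, i.e. `c·P_q < e + 1`
    rw [hnp, hϖn, ← Real.rpow_add hp0, hnt]
    refine Real.rpow_lt_rpow_of_exponent_lt hp1 ?_
    have h2 : c * X.qPilot v / (ramIdx F v : ℝ) < 1 + 1 / (ramIdx F v : ℝ) := by
      rw [div_lt_iff₀ he0, add_mul, one_mul, one_div, inv_mul_cancel₀ he0.ne']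
      linarith
    rw [neg_div]
    linarith
  · -- `‖t_Θ‖ ≤ ‖ϖ‖`: `−c·P_q/e ≤ −1/e`, i.e. `1 ≤ c·P_q`
    rw [hϖn, hnt]
    refine Real.rpow_le_rpow_of_exponent_le hp1.le ?_
    rw [neg_div, neg_le_neg_iff]
    exact (div_le_div_iff_of_pos_right he0).2 (by nlinarith)
  · -- `‖t_q‖ ≤ ‖ϖ‖`: `−P_q/e ≤ −1/e`, i.e. `1 ≤ P_q`
    rw [hϖn, hnq]
    refine Real.rpow_le_rpow_of_exponent_le hp1.le ?_
    rw [neg_div, neg_le_neg_iff]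
    exact (div_le_div_iff_of_pos_right he0).2 hP1

/-! ## 3. The licence and branch C's antecedent for realising ideles on the tame shallow degree locus -/

include ht0 ht htq in
/-- **THE (xi-f) LICENCE AT `settingDHVolSharp` FOR REALISING IDELES ON THE TAME SHALLOW LOCUS**: Θ- and q-ideles realising
`P_Θ`, `P_q`; every bad place `v ∈ S` tame (`p_v > 2`, `e_v ≤ p_v − 2`) with `1 ≤ P_q(v)` and `(l⋇)²·P_q(v) < e_v + 1` (print:
`ord_v(q_v) ≥ 2l`, `(l⋇)²·ord_v(q_v) < 2l·(e_v+1)`) ⟹ `Thm311ToCor312.Licence`. [cite: DupuyHilado2025, §3.4, §3.9, §4.9]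
[cite: WeilBNT1967, Ch. II §2, Th. 1] [claim: Mochizuki2012, status: disputed] -/
theorem licence_settingDHVolSharp_of_realises_shallow
    (htame : ∀ v ∈ X.S, 2 < residueChar F v ∧ ramIdx F v ≤ residueChar F v - 2)
    (hdeg : ∀ v ∈ X.S, 1 ≤ X.qPilot v ∧ ((X.lstar : ℕ) : ℝ) ^ 2 * X.qPilot v < (ramIdx F v : ℝ) + 1) :
    Thm311ToCor312.Licence (settingDHVolSharp X hlog M archPk archSub Ψ act Mmod region n lat sig split qData tq t htq0 htq1) :=
  licence_settingDHVolSharp_of_shallow X hlog M archPk archSub Ψ act Mmod region n lat sig split qData tq t htq0 htq1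
    (fun pp i x hx => norm_eq_one_of_realises X t ht0 ht pp i x hx)
    (fun pp i x hx => window_of_realises_shallow X tq t htq0 ht0 ht htq htame hdeg pp i x hx)

include ht0 ht htq in
/-- **The same at the print-normalised sharp setting `settingPrVolSharp`.** [claim: Mochizuki2012, status: disputed] -/
theorem licence_settingPrVolSharp_of_realises_shallow
    (htame : ∀ v ∈ X.S, 2 < residueChar F v ∧ ramIdx F v ≤ residueChar F v - 2)
    (hdeg : ∀ v ∈ X.S, 1 ≤ X.qPilot v ∧ ((X.lstar : ℕ) : ℝ) ^ 2 * X.qPilot v < (ramIdx F v : ℝ) + 1) :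
    Thm311ToCor312.Licence (settingPrVolSharp X hlog M archPk archSub Ψ act Mmod region n lat sig split qData tq t htq0 htq1) := by
  rw [licence_settingPrVolSharp_iff_settingDHVolSharp]
  exact licence_settingDHVolSharp_of_realises_shallow X hlog M archPk archSub Ψ act Mmod region n lat sig split qData tq t htq0 htq1
    ht0 ht htq htame hdeg

include ht0 ht htq in
/-- **BRANCH C's ANTECEDENT «∃ ρ qK, QPinned ∧ PilotKummerCompatHull» IS INHABITED at `settingPrVolSharp` for realising ideles on
the tame shallow degree locus** (any columns; q-ideles realising `P_q ≥ 0` are integral, `norm_qIdele_le_one_of_realises`). With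
C-cert-1's `thetaSide_of_exists_qPinned_and_hull_settingPrVolSharp` the typed Θ-side inequality follows there.
[cite: DupuyHilado2025, §3.4, §3.9, §4.9] [claim: Mochizuki2012, status: disputed] -/
theorem exists_qPinned_and_hull_settingPrVolSharp_of_realises_shallow
    (htame : ∀ v ∈ X.S, 2 < residueChar F v ∧ ramIdx F v ≤ residueChar F v - 2)
    (hdeg : ∀ v ∈ X.S, 1 ≤ X.qPilot v ∧ ((X.lstar : ℕ) : ℝ) ^ 2 * X.qPilot v < (ramIdx F v : ℝ) + 1) :
    ∃ (ρ : (∀ v : (thetaIndex X).V, v ∈ (thetaIndex X).Vbad → Set ((logShellsDH X logv).StarPacket v)) →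
          ∀ (j : (thetaIndex X).Label) (vQ : (thetaIndex X).VQ), Set ((logShellsDH X logv).Packet j vQ))
        (qK : ∀ v : (thetaIndex X).V, v ∈ (thetaIndex X).Vbad → Set ((logShellsDH X logv).StarPacket v)),
        QPinned ({ toSituation := situationPrVol X hlog M archPk archSub Ψ act Mmod region, col := col } :
            LatticeSituation (thetaIndex X))
          (settingPrVolSharp X hlog M archPk archSub Ψ act Mmod region n lat sig split qData tq t htq0 htq1) ρ qK ∧
        PilotKummerCompatHull ({ toSituation := situationPrVol X hlog M archPk archSub Ψ act Mmod region, col := col } :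
            LatticeSituation (thetaIndex X))
          (settingPrVolSharp X hlog M archPk archSub Ψ act Mmod region n lat sig split qData tq t htq0 htq1) ρ qK :=
  exists_qPinned_and_hull_settingPrVolSharp_of_shallow X hlog M archPk archSub Ψ act Mmod region n lat sig split qData tq t htq0
    htq1 col (fun pp x => norm_qIdele_le_one_of_realises X tq htq0 htq pp x)
    (fun pp i x hx => norm_eq_one_of_realises X t ht0 ht pp i x hx)
    (fun pp i x hx => window_of_realises_shallow X tq t htq0 ht0 ht htq htame hdeg pp i x hx)

/-! ## 4. The degree locus is EMPTY unless every bad place is heavily ramified: `e_v ≥ (l⋇)²` -/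

/-- **The inhabited locus forces HEAVY RAMIFICATION relative to `l`**: `1 ≤ P_q(v)` and `(l⋇)²·P_q(v) < e_v + 1` give
`(l⋇)² ≤ e_v`. So the tame shallow locus of this file is EMPTY at a bad place with `e_v < (l⋇)² = ((l−1)/2)²` — e.g. at
every bad place once `l > 2·√(e_v) + 1`; with `l ≥ 5` it needs `e_v ≥ 4` (honest-scope datum for §D: the locus lives at
small `l` / heavily ramified bad places only; abc-iut-w5-d205 audit memo of p438095, §3). [folklore] -/
theorem lstar_sq_le_ramIdx_of_degree_window {v : HeightOneSpectrum (𝓞 F)}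
    (hdeg : 1 ≤ X.qPilot v ∧ ((X.lstar : ℕ) : ℝ) ^ 2 * X.qPilot v < (ramIdx F v : ℝ) + 1) :
    X.lstar ^ 2 ≤ ramIdx F v := by
  obtain ⟨hP1, hPe⟩ := hdeg
  have h1 : ((X.lstar : ℕ) : ℝ) ^ 2 ≤ ((X.lstar : ℕ) : ℝ) ^ 2 * X.qPilot v :=
    le_mul_of_one_le_right (by positivity) hP1
  have h2 : ((X.lstar ^ 2 : ℕ) : ℝ) < ((ramIdx F v + 1 : ℕ) : ℝ) := by
    push_cast
    exact lt_of_le_of_lt h1 hPe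
  have h3 : X.lstar ^ 2 < ramIdx F v + 1 := by exact_mod_cast h2
  omega

end Summit.ABC.IUTFork.Thm311.Real

end
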